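import Summits.ResolutionOfSingularities.ResolutionOfSingularities.Theorems.FrobeniusLadderFInjectiveMacaulayficationDedekindBlowupCharts
import Summits.ResolutionOfSingularities.ResolutionOfSingularities.Theorems.FrobeniusLadderFInjectiveMacaulayficationFiClauseOfRegular
import Mathlib.RingTheory.DedekindDomain.IntegralClosure
import Mathlib.RingTheory.KrullDimension.Field
import Mathlib.RingTheory.Localization.Integer
import Mathlib.AlgebraicGeometry.Morphisms.FiniteType
import Mathlib.AlgebraicGeometry.FunctionField
import Mathlib.AlgebraicGeometry.Noetherian
import HarnessLib

/-!
# 5e IN DIMENSION ONE: point-fixability of the local ring of a curve via the conductor blow-up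
# (crux `FInjectiveMacaulayfication` stmt-ResolutionOfSingularities-15315, chain w45a, plan-1 R13.14 (3), part 2/2)

[OURS · L1 W4.5a · res-D-pv-019 AS res-L1-w45a-stub-7] Support file (`--supports stmt-ResolutionOfSingularities-15315 --as
helper`) for the crux `FrobeniusLadder.FInjectiveMacaulayfication`; NOT a statement of any manuscript; AI-written, weaker than
expert review.

THE STATEMENT (`pointFix_of_dim_one`, ring level = the `h4Loc` binder of
`GenericFibreReduction.fInjectiveMacaulayfication_of_h4Loc_of_fc_named` at a closed point `b` with `dim 𝒪_{X₁,b} = 1`, the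
finiteness of the normalisation entering as a hypothesis). Let `A` be a Noetherian local DOMAIN of Krull dimension `1` and prime
characteristic `p` whose normalisation `B := integralClosure A (Frac A)` is a finite `A`-module. Then there are `c : Fin n → A` with
`I := (c) ≠ 0`, `√I = 𝔪_A`, such that for every chart `A[I/c_j]` of the blowing up of `Spec A` along `I` and every prime `𝔔` of
`A[I/c_j]` over `𝔪_A`, the local ring `A[I/c_j]_𝔔` is a domain satisfying the FULL clause of the crux (every system of parameters
weakly regular, every parameter ideal Frobenius closed). In fact (`exists_isRegularLocalRing_charts_of_dim_one`) these local rings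
are DISCRETE VALUATION RINGS. No `¬ FULL` hypothesis is needed: the conclusion holds at every closed point of a curve.

THE PROOF (tri-2 F49/F50 «PFix in dim 1 is free via the conductor»).
1. CONDUCTOR (`exists_bIdeal`). `𝔠 := {x ∈ A | x·B ⊆ A}` is a nonzero ideal of `A` (it contains a common denominator of the
   finitely many generators of `B ⊆ Frac A`) and a `B`-ideal; `I := 𝔠·𝔪_A` is then a nonzero `B`-ideal inside `𝔪_A`, so
   `√I = 𝔪_A` (`dim A = 1`, `A` local, `radical_eq_maximalIdeal_of_dim_one`).
2. `B` is a DEDEKIND DOMAIN (`isDedekindDomain_integralClosure`: finite over the Noetherian `A` ⇒ Noetherian; integral over `A` of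
   dimension `≤ 1` ⇒ dimension `≤ 1`; integrally closed in `Frac A = Frac B`).
3. Part 1/2 (`…DedekindBlowupCharts.lean`): by ABSORPTION `A[I/a] ≅ B[IB/a]` and valuation-ring domination, every local ring of
   `A[I/a]` at a prime over `𝔪_A ≠ 0` is a DVR, so REGULAR; REGULAR ⇒ FULL is the tree's `FiClauseOfRegular.stub_fiClauseOfRegular`
   (Matsumura 17.4 + Kunz 1969, PROVED there).
No sorry, no new definitions, no named facts; `hfin` (finiteness of the normalisation) is discharged by excellence / E. Noether for
local rings of varieties — not in this file.
-/

-- single-problem summit: the doubled namespace component is forced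
set_option linter.dupNamespace false

noncomputable section

open IsLocalRing Literature.AlgebraicGeometry.Resolution AlgebraicGeometry CategoryTheory
open Summit.ResolutionOfSingularities.ResolutionOfSingularities.Theorems.FInjectiveMacaulayfication.DedekindBlowupCharts

namespace Summit.ResolutionOfSingularities.ResolutionOfSingularities.Theorems.FInjectiveMacaulayfication.PointFixDimOne

/-! ## 1. The normalisation of a one-dimensional Noetherian domain (finite case) is Dedekind -/

/-- If `A` is a Noetherian domain of dimension `≤ 1` whose integral closure `B` in `K = Frac A` is a finite `A`-module, then `B` is
a Dedekind domain (Noetherian as a finite algebra; dimension `≤ 1` by integrality; integrally closed in `K = Frac B`). [folklore] -/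
theorem isDedekindDomain_integralClosure (A : Type) [CommRing A] [IsDomain A] [IsNoetherianRing A] [Ring.DimensionLEOne A]
    (hfin : Module.Finite A (integralClosure A (FractionRing A))) :
    IsDedekindDomain (integralClosure A (FractionRing A)) := by
  haveI : IsFractionRing (integralClosure A (FractionRing A)) (FractionRing A) :=
    integralClosure.isFractionRing_of_finite_extension (FractionRing A) (FractionRing A)
  haveI : IsNoetherianRing (integralClosure A (FractionRing A)) := Algebra.FiniteType.isNoetherianRing A _
  refine (isDedekindDomain_iff (A := integralClosure A (FractionRing A)) (FractionRing A)).mpr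
    ⟨inferInstance, inferInstance, inferInstance, ?_⟩
  intro x hx
  exact (IsIntegrallyClosedIn.isIntegral_iff (R := integralClosure A (FractionRing A)) (A := FractionRing A)).mp hx

/-! ## 2. The conductor: a nonzero `B`-ideal of `A` inside `𝔪_A` -/

/-- **Conductor-type ideal.** Let `A` be a local domain which is not a field, `K = Frac A`, and `B ⊆ K` an `A`-subalgebra which is
a finite `A`-module (e.g. the normalisation). Then there is an ideal `I` of `A` with `I ≠ 0`, `I ⊆ 𝔪_A`, which is a `B`-ideal:
`b · x ∈ I` (inside `B`) for all `b ∈ B`, `x ∈ I`. (Take `I = 𝔠·𝔪_A`, `𝔠 = {x | x B ⊆ A}` the conductor, which contains a common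
denominator of the generators of `B`.) [folklore] -/
theorem exists_bIdeal (A : Type) [CommRing A] [IsDomain A] [IsLocalRing A] {K : Type} [Field K] [Algebra A K]
    [IsFractionRing A K] (B : Subalgebra A K) (hfin : Module.Finite A B) (h𝔪 : maximalIdeal A ≠ ⊥) :
    ∃ I : Ideal A, I ≠ ⊥ ∧ I ≤ maximalIdeal A ∧
      ∀ (b : B) (x : A), x ∈ I → ∃ y ∈ I, algebraMap A B y = b * algebraMap A B x := by
  classical
  -- the conductor `𝔠 = {x | ∀ b ∈ B, b x ∈ A}`
  let 𝔠 : Ideal A :=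
    { carrier := {x | ∀ b : B, ∃ y : A, algebraMap A K y = (b : K) * algebraMap A K x}
      zero_mem' := fun b => ⟨0, by simp only [map_zero, mul_zero]⟩
      add_mem' := fun {x₁ x₂} h₁ h₂ b => by
        obtain ⟨y₁, hy₁⟩ := h₁ b
        obtain ⟨y₂, hy₂⟩ := h₂ b
        exact ⟨y₁ + y₂, by rw [map_add, hy₁, hy₂, map_add, mul_add]⟩
      smul_mem' := fun a {x} hx b => by
        obtain ⟨y, hy⟩ := hx b
        exact ⟨a * y, by rw [smul_eq_mul, map_mul, map_mul, hy]; ring⟩ }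
  have h𝔠B : ∀ (b : B) (x : A), x ∈ 𝔠 → ∃ y ∈ 𝔠, algebraMap A K y = (b : K) * algebraMap A K x := by
    intro b x hx
    obtain ⟨y, hy⟩ := hx b
    refine ⟨y, fun b' => ?_, hy⟩
    obtain ⟨y', hy'⟩ := hx (b' * b)
    exact ⟨y', by rw [hy', hy, Subalgebra.coe_mul, mul_assoc]⟩
  -- `𝔠 ≠ 0`: a common denominator of the generators of `B`
  have h𝔠ne : 𝔠 ≠ ⊥ := by
    obtain ⟨s, hs⟩ := Module.Finite.fg_top (R := A) (M := B)
    obtain ⟨⟨d, hd⟩, hdint⟩ :=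
      IsLocalization.exist_integer_multiples_of_finset (nonZeroDivisors A) (s.image fun b : B => (b : K))
    have hd0 : d ≠ 0 := nonZeroDivisors.ne_zero hd
    have hdmem : d ∈ 𝔠 := by
      intro b
      have hb : b ∈ Submodule.span A (s : Set B) := by rw [hs]; exact Submodule.mem_top
      induction hb using Submodule.span_induction with
      | mem b hb =>
        obtain ⟨y, hy⟩ := hdint (b : K) (Finset.mem_image_of_mem _ hb)
        exact ⟨y, by rw [hy, Algebra.smul_def, mul_comm]⟩
      | zero => exact ⟨0, by rw [map_zero, ZeroMemClass.coe_zero, zero_mul]⟩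
      | add b₁ b₂ _ _ h₁ h₂ =>
        obtain ⟨y₁, hy₁⟩ := h₁
        obtain ⟨y₂, hy₂⟩ := h₂
        exact ⟨y₁ + y₂, by rw [map_add, hy₁, hy₂, Subalgebra.coe_add, add_mul]⟩
      | smul a b _ h =>
        obtain ⟨y, hy⟩ := h
        exact ⟨a * y, by rw [map_mul, hy, Subalgebra.coe_smul, Algebra.smul_def, mul_assoc]⟩
    intro h
    rw [h] at hdmem
    exact hd0 hdmem
  refine ⟨𝔠 * maximalIdeal A, ?_, Ideal.mul_le_left, ?_⟩
  · exact fun h => (Ideal.mul_eq_bot.mp h).elim h𝔠ne h𝔪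
  · intro b x hx
    -- `B`-ideal property of `𝔠·𝔪`, by induction on the product
    suffices h : ∃ y ∈ 𝔠 * maximalIdeal A, algebraMap A K y = (b : K) * algebraMap A K x by
      obtain ⟨y, hy, hyx⟩ := h
      exact ⟨y, hy, Subtype.ext hyx⟩
    refine Submodule.mul_induction_on hx (fun a ha m hm => ?_) (fun x₁ x₂ h₁ h₂ => ?_)
    · obtain ⟨y, hy𝔠, hy⟩ := h𝔠B b a ha
      exact ⟨y * m, Ideal.mul_mem_mul hy𝔠 hm, by rw [map_mul, hy, map_mul, mul_assoc]⟩
    · obtain ⟨y₁, hy₁, h₁'⟩ := h₁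
      obtain ⟨y₂, hy₂, h₂'⟩ := h₂
      exact ⟨y₁ + y₂, Ideal.add_mem _ hy₁ hy₂, by rw [map_add, h₁', h₂', map_add, mul_add]⟩

/-! ## 3. The main theorem: `5e` holds in dimension one -/

/-- In a local domain of Krull dimension `1`, the radical of every nonzero ideal `I ⊆ 𝔪` is `𝔪`. [folklore] -/
theorem radical_eq_maximalIdeal_of_dim_one {A : Type} [CommRing A] [IsDomain A] [IsLocalRing A]
    (hdim : ringKrullDim A = 1) {I : Ideal A} (hI : I ≠ ⊥) (hI𝔪 : I ≤ maximalIdeal A) :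
    I.radical = maximalIdeal A := by
  haveI : Ring.KrullDimLE 1 A := Ring.krullDimLE_iff.mpr hdim.le
  rw [Ideal.radical_eq_sInf]
  refine le_antisymm (sInf_le ⟨hI𝔪, inferInstance⟩) (le_sInf ?_)
  rintro J ⟨hIJ, hJ⟩
  rw [IsLocalRing.eq_maximalIdeal (hJ.isMaximal_of_ne_bot fun h => hI (le_bot_iff.mp (h ▸ hIJ)))]

/-- **The chart local rings are DVRs** (structural form): for a Noetherian local domain `A` of Krull dimension `1` whose
normalisation is a finite `A`-module there are `c : Fin n → A`, `(c) ≠ 0`, `√(c) = 𝔪_A`, such that every local ring of every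
chart `A[(c)/c_j]` at a prime over `𝔪_A` is a REGULAR local ring (a DVR). [folklore] -/
theorem exists_isRegularLocalRing_charts_of_dim_one (A : Type) [CommRing A] [IsDomain A] [IsNoetherianRing A]
    [IsLocalRing A] (hdim : ringKrullDim A = 1) (hfin : Module.Finite A (integralClosure A (FractionRing A))) :
    ∃ (n : ℕ) (c : Fin n → A), Ideal.span (Set.range c) ≠ ⊥ ∧
      (Ideal.span (Set.range c)).radical = IsLocalRing.maximalIdeal A ∧
      ∀ (j : Fin n) (𝔔 : PrimeSpectrum (blowupAlgebra (Ideal.span (Set.range c)) (c j))),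
        𝔔.asIdeal.comap (algebraMap A (blowupAlgebra (Ideal.span (Set.range c)) (c j))) =
            IsLocalRing.maximalIdeal A →
          IsRegularLocalRing (Localization.AtPrime 𝔔.asIdeal) := by
  classical
  have h𝔪 : maximalIdeal A ≠ ⊥ := by
    intro h
    have hF := ringKrullDim_eq_zero_of_isField (IsLocalRing.isField_iff_maximalIdeal_eq.mpr h)
    rw [hdim] at hF
    exact one_ne_zero hF
  haveI : Ring.KrullDimLE 1 A := Ring.krullDimLE_iff.mpr hdim.le
  haveI : Ring.DimensionLEOne A := ⟨fun {P} hP hPp => hPp.isMaximal_of_ne_bot hP⟩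
  haveI : IsDedekindDomain (integralClosure A (FractionRing A)) := isDedekindDomain_integralClosure A hfin
  have hφ : Function.Injective (algebraMap A (integralClosure A (FractionRing A))) := fun x y h =>
    IsFractionRing.injective A (FractionRing A) (congrArg Subtype.val h)
  obtain ⟨I, hIne, hI𝔪, hIB⟩ := exists_bIdeal A (integralClosure A (FractionRing A)) hfin h𝔪
  obtain ⟨n, c, hc⟩ := Submodule.fg_iff_exists_fin_generating_family.mp ((isNoetherianRing_iff_ideal_fg A).mp ‹_› I)
  subst hc
  refine ⟨n, c, hIne, radical_eq_maximalIdeal_of_dim_one hdim hIne hI𝔪, fun j 𝔔 h𝔔 => ?_⟩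
  by_cases hcj : c j = 0
  · haveI : Subsingleton (Localization.Away (c j)) :=
      IsLocalization.subsingleton (M := Submonoid.powers (c j)) (S := Localization.Away (c j))
        ⟨1, by simp only [pow_one, hcj]⟩
    exact absurd (Subsingleton.elim _ _) 𝔔.isPrime.ne_top
  exact isRegularLocalRing_atPrime_chart_of_absorb (algebraMap A (integralClosure A (FractionRing A))) hφ
    (Ideal.span (Set.range c)) (Ideal.subset_span ⟨j, rfl⟩) hcj hIB 𝔔.asIdeal (by rw [h𝔔]; exact h𝔪)

/-- **5e IN DIMENSION ONE (ring level).** Let `A` be a Noetherian local domain of Krull dimension `1` and prime characteristic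
`p`, whose normalisation `integralClosure A (Frac A)` is a finite `A`-module. Then `A` is POINT-FIXABLE in the sense of the
crux's `h4Loc` binder: there are `c : Fin n → A` with `(c) ≠ 0`, `√(c) = 𝔪_A`, such that every local ring of every chart
`A[(c)/c_j]` at a prime over `𝔪_A` is a domain satisfying the FULL clause (systems of parameters weakly regular, parameter
ideals Frobenius closed) — indeed a DVR (`exists_isRegularLocalRing_charts_of_dim_one`), and REGULAR ⇒ FULL
(`FiClauseOfRegular.stub_fiClauseOfRegular`). [folklore] -/
theorem pointFix_of_dim_one (p : ℕ) [Fact p.Prime] (A : Type) [CommRing A] [IsDomain A] [IsNoetherianRing A]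
    [IsLocalRing A] [CharP A p] (hdim : ringKrullDim A = 1)
    (hfin : Module.Finite A (integralClosure A (FractionRing A))) :
    ∃ (n : ℕ) (c : Fin n → A), Ideal.span (Set.range c) ≠ ⊥ ∧
      (Ideal.span (Set.range c)).radical = IsLocalRing.maximalIdeal A ∧
      ∀ (j : Fin n) (𝔔 : PrimeSpectrum (blowupAlgebra (Ideal.span (Set.range c)) (c j))),
        𝔔.asIdeal.comap (algebraMap A (blowupAlgebra (Ideal.span (Set.range c)) (c j))) =
            IsLocalRing.maximalIdeal A →
          IsDomain (Localization.AtPrime 𝔔.asIdeal) ∧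
            ∀ d : ℕ, ringKrullDim (Localization.AtPrime 𝔔.asIdeal) = d →
              ∀ s : Fin d → Localization.AtPrime 𝔔.asIdeal, (Ideal.span (Set.range s)).radical.IsMaximal →
                RingTheory.Sequence.IsWeaklyRegular (Localization.AtPrime 𝔔.asIdeal) (List.ofFn s) ∧
                  ∀ y : Localization.AtPrime 𝔔.asIdeal,
                    (∃ e : ℕ, y ^ p ^ e ∈ Ideal.span ((fun z : Localization.AtPrime 𝔔.asIdeal => z ^ p ^ e) ''
                      (Ideal.span (Set.range s) : Set (Localization.AtPrime 𝔔.asIdeal)))) →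
                    y ∈ Ideal.span (Set.range s) := by
  obtain ⟨n, c, hne, hrad, hreg⟩ := exists_isRegularLocalRing_charts_of_dim_one A hdim hfin
  refine ⟨n, c, hne, hrad, fun j 𝔔 h𝔔 => ?_⟩
  have hcj : c j ≠ 0 := by
    intro hcj
    haveI : Subsingleton (Localization.Away (c j)) :=
      IsLocalization.subsingleton (M := Submonoid.powers (c j)) (S := Localization.Away (c j))
        ⟨1, by simp only [pow_one, hcj]⟩
    exact 𝔔.isPrime.ne_top (Subsingleton.elim _ _)
  haveI := hreg j 𝔔 h𝔔
  haveI := charP_atPrime_blowupAlgebra p (Ideal.span (Set.range c)) hcj 𝔔.asIdeal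
  exact FiClauseOfRegular.stub_fiClauseOfRegular p (Localization.AtPrime 𝔔.asIdeal)

/-! ## 4. Scheme level: the `h4Loc` binder at a closed point of a curve -/

/-- **5e IN DIMENSION ONE (scheme level, `h4Loc` at `dim 𝒪_{X₁,b} = 1`).** For `X₁` integral and locally of finite type over a
field `k` of characteristic `p` and a point `b` with `dim 𝒪_{X₁,b} = 1` whose normalisation `integralClosure 𝒪_{X₁,b} (Frac)` is a
finite `𝒪_{X₁,b}`-module, the conclusion of the `h4Loc` binder of `GenericFibreReduction.fInjectiveMacaulayfication_of_h4Loc_of_fc_named`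
holds at `b` (VERBATIM): generators `c` of a nonzero ideal with radical `𝔪_b` all of whose blow-up chart local rings over `𝔪_b` are
domains satisfying the FULL clause. (`𝒪_{X₁,b}` is a Noetherian local domain of characteristic `p`; apply `pointFix_of_dim_one`.)
[folklore] -/
theorem h4Loc_of_dim_one (p : ℕ) (hp : p.Prime) (k : Type) [Field k] [CharP k p] (X₁ : Scheme.{0})
    (f₁ : X₁ ⟶ Spec (.of k)) [LocallyOfFiniteType f₁] [IsIntegral X₁] (b : X₁)
    (hdim : ringKrullDim (X₁.presheaf.stalk b) = 1)
    (hfin : Module.Finite (X₁.presheaf.stalk b)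
      (integralClosure (X₁.presheaf.stalk b) (FractionRing (X₁.presheaf.stalk b)))) :
    ∃ (n : ℕ) (c : Fin n → X₁.presheaf.stalk b), Ideal.span (Set.range c) ≠ ⊥ ∧
      (Ideal.span (Set.range c)).radical = IsLocalRing.maximalIdeal (X₁.presheaf.stalk b) ∧
      ∀ (j : Fin n) (𝔔 : PrimeSpectrum (Literature.AlgebraicGeometry.Resolution.blowupAlgebra (Ideal.span (Set.range c)) (c j))),
        𝔔.asIdeal.comap (algebraMap (X₁.presheaf.stalk b)
            (Literature.AlgebraicGeometry.Resolution.blowupAlgebra (Ideal.span (Set.range c)) (c j))) =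
          IsLocalRing.maximalIdeal (X₁.presheaf.stalk b) →
        IsDomain (Localization.AtPrime 𝔔.asIdeal) ∧ ∀ d : ℕ, ringKrullDim (Localization.AtPrime 𝔔.asIdeal) = d →
          ∀ s : Fin d → Localization.AtPrime 𝔔.asIdeal, (Ideal.span (Set.range s)).radical.IsMaximal →
            RingTheory.Sequence.IsWeaklyRegular (Localization.AtPrime 𝔔.asIdeal) (List.ofFn s) ∧
            ∀ y : Localization.AtPrime 𝔔.asIdeal, (∃ e : ℕ, y ^ p ^ e ∈ Ideal.span
              ((fun z : Localization.AtPrime 𝔔.asIdeal => z ^ p ^ e) ''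
                (Ideal.span (Set.range s) : Set (Localization.AtPrime 𝔔.asIdeal)))) → y ∈ Ideal.span (Set.range s) := by
  haveI : Fact p.Prime := ⟨hp⟩
  haveI : IsLocallyNoetherian X₁ := LocallyOfFiniteType.isLocallyNoetherian f₁
  -- adapted from `Negative.charP_stalk` / `RegularPointClause`: the stalk receives a ring map from the field `k`
  haveI : CharP (X₁.presheaf.stalk b) p :=
    CharP.of_ringHom_of_ne_zero
      ((X₁.presheaf.germ ⊤ b trivial).hom.comp (f₁.appTop.hom.comp (Scheme.ΓSpecIso (.of k)).inv.hom)) p hp.ne_zero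
  exact pointFix_of_dim_one p (X₁.presheaf.stalk b) hdim hfin

end Summit.ResolutionOfSingularities.ResolutionOfSingularities.Theorems.FInjectiveMacaulayfication.PointFixDimOne

end
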